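import Mathlib.Topology.MetricSpace.PiNat
import Mathlib.Topology.Homeomorph.Lemmas
import Mathlib.Topology.Algebra.Ring.Basic
import Mathlib.Analysis.SpecialFunctions.Pow.Real
import Mathlib.Algebra.BigOperators.Finprod
import Mathlib.Algebra.Polynomial.Eval.Defs
import Mathlib.FieldTheory.IsAlgClosed.Basic
import Mathlib.NumberTheory.NumberField.Basic
import HarnessLib

/-!
# Joshi, *Arithmetic Teichmüller Spaces II½ — Deformations of Number Fields* (arXiv:2305.10398), §4–§5:
# the adelic Fargues–Fontaine curve `𝒴_L`, its three actions and global Frobenius, ARITHMETICOIDS — typed, no side taken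

Block E typing file (cell abc-iut, rung LADDER-ABC:A2.E, seat abc-iut-E-t37, slot T-37; inventory
`HOME/plan/E/t37/INVENTORY.tsv`; scope = E-PLAN ruling R11: only the [J-2½] items that [J-III]/[J-IV] cross-cite on the
S-spine). TAKES NO SIDE on [IUTchIII] Cor. 3.12, on Joshi's claims, or on Mochizuki's reports on them; typed ≠ proved;
typed AS A CANDIDATE ≠ endorsed. SOURCE: [J-2½] = K. Joshi, *Construction of Arithmetic Teichmuller Spaces II½:
Deformations of Number Fields*, unrefereed arXiv preprint 2305.10398 ("Preliminary version for comments"), the version held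
as lit key `paper:arxiv-2305.10398` (bib `Joshi2023ATS2half`; 75 pp.; render
`HOME/plan/repair/lit/renders/Joshi-arxiv-2305.10398-ATS2half/pNNNN.txt`, «p.N l.M» = line M of the page file of PDF page N).
It is [Joshi, 2023a] of [J-III] = arXiv:2401.13508v4 and of [J-IV] = arXiv:2403.10430v2. Claim status of the series:
rejected by the IUT author [Mochizuki2024JoshiReport], accepted by neither side of the dispute (D-0012): every statement Joshi
ASSERTS is a `def … : Prop` carrying `@[claim "Joshi2023ATS2half" "disputed"]` («disputed» records that a dispute exists in
print; it takes no side), NEVER an axiom / instance / theorem; DATA he defines is a `structure` / `def` AS HE DEFINES IT; a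
property that FOLLOWS from the typed signature is a proved `theorem` (a DISCHARGED row).

## What is typed (one declaration per printed item; node ids of `HOME/plan/E/JOSHI-DAG.tsv`)

* §2.3 (p.11 l.30 – p.12 l.22) `IsValuedField` — Joshi's valued fields in Bourbaki's sense (weak triangle inequality with a
  constant `A`; archimedean untilts `(ℂ, |−|^s_ℂ)`, `s > 0`, are admitted, so `|−|_{K}` is NOT typed as a Mathlib
  `AbsoluteValue`).
* THE SIGNATURE `DeformationDatum` (§2.2, §2.4, §4.1, §4.2, §5.1, §5.3; the facts of [Fargues–Fontaine 2018] = [FF18] and of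
  [J-I] = arXiv:2106.11452 that Joshi invokes are FIELDS with locators; nothing is asserted, nothing instantiated): a number
  field `L`, its places `V_L ⊇ V^arc_L`, completions `L_v`, the closed classical points `|Y_{F_v,L_v}|` of the local
  Fargues–Fontaine curves with their Frobenii `ϕ_v`, the local actions of `G_v`, of `L* ⊂ L_v*` and of
  `Aut_{𝒪_{L_v}}(𝒢(𝒪_{F_v}))`, the residue fields `K_{y}` (untilts) with `|−|_{K_y}` and `L_v ↪ K_y`, the standard
  absolute values `|−|_v` with the product formula (5.3.1)–(5.3.2) [Artin–Whaples 1945], and the normalization coordinate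
  `α_y` of (5.3.3)–(5.3.5). ONE signature types Def. 4.1.1 (`F_v = L̂̄_v^♭`), Rmk. 4.1.3 (`F_v = ℂ_{p_v}^♭`, the variant
  `𝒴′_L` that [J-III] §4 uses), Def. 4.7.1 (`F_v` maximally complete) and Def. 4.8.1 (`F_v = 𝔽̄_p((t^ℝ))`, «realified»):
  they differ only in the choice of the perfectoid base fields, recorded by the tag `DeformationDatum.base : TiltBase`.
* J2h:Def4.1.1 `Ycal` = `𝒴_L = ∏_{v ∈ V_L} |Y_{L̂_v^♭,L_v}|` (dependent product, product topology) · J2h:Lem4.1.2 =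
  J2h:Thm5.1.5 `ycal_metrizable` / `arith_metrizable` (DERIVED: countable product of metrisable spaces, Mathlib `PiCountable`)
  · J2h:Rmk4.1.3 / J2h:Def4.7.1 / J2h:Def4.8.1 (tags `TiltBase.cp` / `.maxComplete` / `.realified`, Props `IsRmk413` …)
  · J2h:Thm4.2.3 (1) `galAction`, (2) `frobY`, (3) `unitAction`, (6) `ltAction` (CONSTRUCTIONS, factorwise, as in the proof
  p.23 l.14–92), (4) `LActsByFrobeniusPowers` (claim), (5)/(8) prose (docstrings), (7) = the explicit formula on primitive
  degree-one elements `σ_v([a_v] − π_v) = [σ_v(a_v)] − π_v` = [J-I] Thm. 7.29.1, typed in block-E seat E-t1's ATS-I files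
  (merge-debt; not retyped here) · J2h:Cor4.2.5 `frobY`, `frobY_apply`, `continuous_frobY` (DERIVED) · J2h:Def5.1.1 `Arith` (an
  arithmeticoid IS a point `y ∈ 𝒴_L`), `localDatum`, `arithRing` (`R_y = ∏_v K_{y_v}`), `iotaL` (Lem. 5.1.3's `L ↪ R_y`) ·
  J2h:Def5.9.1 `Lone` (`L_y ↦ L_y^{(1)} := L_{ϕ(y)}`, the «global Frobenius morphism of a number field» [J-IV] Thm. 6.10.1 cites).
* COMPANION FILES (same seat): `Joshi/ArithmeticoidProperties.lean` — J2h:Prop4.7.2 / J2h:Prop4.8.3, Lem. 5.1.3, Def. 5.2.1,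
  J2h:Thm5.5.2, Cor. 5.7.1; `Joshi/ArithmeticoidPeriods.lean` — J2h:Def4.5.1 (`B_L ⊃ B_L^+`, `B_L(1)`), §5.3–5.4 (normalized
  arithmeticoids, ideloid, `deg_y`), J2h:Thm5.10.1 (the period mapping `y ↦ H_y`), J2h:Def5.14.1 (the Frobenioid of `L`).

MODELLING CHOICES (for the faithfulness referee): (a) all point sets, groups and fields are abstract carriers (parameters,
so that no instance is declared); (b) `ϕ_v` and every acting element are HOMEOMORPHISMS of `|Y_{F_v,L_v}|` (Joshi: «Frobenius
morphism», «natural action»; invertibility is what Thm. 4.2.3 (4) «powers of ϕ_v» needs for `x ∈ L*` of negative valuation);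
(c) `ϕ_v = 1`, `p_v = 1`, trivial valuation at archimedean `v` (§4.5 p.26 l.64; Cor. 5.6.2 p.35 l.53–54); (d) all absolute
values are `ℝ`-valued (J2p Prop. 2.7.1 modelling choice of seat E-t3); (e) the tilts `K^♭_y ≃ L̂_v^♭` of Def. 5.1.1 are NOT
recorded (as in seat E-t1's `Untilt`): a point `y_v` IS the untilt datum, and distinct points index distinct data.
OUR SIDE: nothing here mentions the Cor. 3.12 vocabulary; per E-PLAN R14 only `Joshi/Dictionary*.lean` / `Joshi/Test*.lean` bind
our frozen objects. Nearest typed objects (BY NAME, docstrings only): seat E-t7's `Joshi.AdelicCurveDatum` ([J-III] §4.1's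
`𝒴′_{L′}` with `ℓ*`, `V^{odd,ss}` and the Ansatz — a CONSUMER of Def. 4.1.1 / Thm. 4.2.3), seat T-10's
`Joshi.ATS3.ModuliDescentDatum.Arith`, seat E-t3's `Joshi.PeriodRingDatum` (one place `p`, `F = ℂ_p^♭`), seat E-t1's
`Joshi.Untilt`. Merge-debts are recorded in `HOME/plan/E/ASSIGNMENTS.md §3` (R12: later filers import BY NAME, no renames).
-/

noncomputable section

open TopologicalSpace

namespace Summit.ABC.IUTFork.Joshi.ATS2h

universe u

/-! ## §2.3 Valued fields in Bourbaki's sense (archimedean untilts admitted) -/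

/-- **[J-2½] §2.3** (p.11 l.33 – p.12 l.3): a VALUED FIELD `(K, |−|_K)` in the sense of [Bourbaki, Alg. Comm. VI §6.1]:
`|−|_K : K → ℝ_{≥0}` with «(1) `|x|_K = 0` iff `x = 0`, (2) `|x·y|_K = |x|_K·|y|_K`, (3) there exists a real number `A > 0`
such that `|x + y|_K ≤ A·max(|x|_K, |y|_K)`»; «I will only work with non-trivially valued fields» (the image of `K*` is not
`{1}`). Non-archimedean iff one may take `A = 1`; `(ℂ, |−|^s_ℂ)`, `s > 0`, is archimedean (Prop. 2.3.1, Def. 2.3.2).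
[claim: Joshi2023ATS2half, status: disputed] -/
structure IsValuedField {K : Type u} [Field K] (abs : K → ℝ) : Prop where
  /-- values are nonnegative -/
  nonneg : ∀ x, 0 ≤ abs x
  /-- (1) `|x| = 0 ↔ x = 0` -/
  eq_zero_iff : ∀ x, abs x = 0 ↔ x = 0
  /-- (2) multiplicativity -/
  map_mul : ∀ x y, abs (x * y) = abs x * abs y
  /-- (3) the weak triangle inequality with a constant `A > 0` -/
  exists_const : ∃ A : ℝ, 0 < A ∧ ∀ x y, abs (x + y) ≤ A * max (abs x) (abs y)
  /-- non-trivially valued -/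
  nontrivial : ∃ x, x ≠ 0 ∧ abs x ≠ 1

namespace IsValuedField

variable {K : Type u} [Field K] {abs : K → ℝ}

/-- `|1|_K = 1`. [folklore] -/
theorem map_one (h : IsValuedField abs) : abs 1 = 1 := by
  have h1 : abs 1 * abs 1 = abs 1 * 1 := by rw [mul_one, ← h.map_mul, mul_one]
  have hne : abs 1 ≠ 0 := fun h0 => one_ne_zero ((h.eq_zero_iff 1).1 h0)
  exact mul_left_cancel₀ hne h1

/-- `|x|_K > 0` for `x ≠ 0`. [folklore] -/
theorem pos_of_ne_zero (h : IsValuedField abs) {x : K} (hx : x ≠ 0) : 0 < abs x :=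
  lt_of_le_of_ne (h.nonneg x) (fun h0 => hx ((h.eq_zero_iff x).1 h0.symm))

/-- `|x⁻¹|_K = |x|_K⁻¹`. [folklore] -/
theorem map_inv (h : IsValuedField abs) (x : K) : abs x⁻¹ = (abs x)⁻¹ := by
  by_cases hx : x = 0
  · subst hx; simp [(h.eq_zero_iff 0).2 rfl]
  · have hx' : abs x ≠ 0 := (h.pos_of_ne_zero hx).ne'
    have : abs x * abs x⁻¹ = abs x * (abs x)⁻¹ := by
      rw [← h.map_mul, mul_inv_cancel₀ hx, h.map_one, mul_inv_cancel₀ hx']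
    exact mul_left_cancel₀ hx' this

end IsValuedField

/-! ## The signature of §4–§5 -/

/-- The four choices of perfectoid base fields `F_v` over which [J-2½] forms the adelic curve: **Def. 4.1.1** (p.20 l.18–69)
`F_v = L̂̄_v^♭`, the tilt of the completed algebraic closure of `L_v`; **Rmk. 4.1.3** (p.20 l.92 – p.21 l.45) `F_v = ℂ_{p_v}^♭`
(«the following variant `𝒴′_L` … will also be considered»; it is the variant [J-III] §4 uses); **Def. 4.7.1** (p.27 l.42 –
p.28 l.16) `F_v = (L̂^max_v)^♭`, `L̂^max_v ⊇ L_v` maximally complete ([Kaplansky 1942], [Poonen 1993]); **Def. 4.8.1** (p.28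
l.58 – p.29 l.15) `F_v = 𝒞^♭_{p_v} = 𝔽̄_p((t^ℝ))` (Hahn–Mal'cev series: residue field `𝔽̄_p`, value group `ℝ`, maximally
complete) for `v ∈ V^non` and `F_v = ℂ^♭ = ℂ` for `v ∈ V^arc` — the «realified» curves. [claim: Joshi2023ATS2half, status: disputed] -/
inductive TiltBase : Type where
  /-- Def. 4.1.1: `𝒴_L`, `F_v = L̂̄_v^♭` -/
  | algClosure
  /-- Rmk. 4.1.3: `𝒴′_L`, `F_v = ℂ_{p_v}^♭` -/
  | cp
  /-- Def. 4.7.1: `𝒴^max_L` -/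
  | maxComplete
  /-- Def. 4.8.1: `𝒴^ℝ_L` -/
  | realified
  deriving DecidableEq

/-- **SIGNATURE of [J-2½] §4–§5** (HYPOTHESIS structure; nothing asserted, never instantiated here) over abstract carriers:
`L` «a number field» (§2.2 p.11 l.22–29: «I will assume for simplicity that `L` has no real embeddings» — a standing
assumption of print, not used by any typed statement below; only the field structure of `L` enters);
`V = V_L` «the set of inequivalent non-trivial valuations of L» with `V^arc_L ⊂ V_L` (§2.2); `L_v` «the completion of L at v»
with `L ↪ L_v` (Def. 4.1.1 p.20 l.18); `Y v = |Y_{F_v,L_v}|` «the topological space of closed classical points of the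
Fargues–Fontaine curve» (p.20 l.24–39; for `v ∈ V^arc`, `Y_{ℂ^♭,ℂ} = ℝ_{>0}` (2.4.1) p.12 l.28–29), each metrisable ([FF18,
Prop. 2.3.2] as used p.20 l.79–89) and inhabited by the point `y⁰_v` of the untilt `(L_v ↪ L̂̄_v, L̂̄_v^♭ = L̂̄_v^♭)` (proof of
Thm. 5.5.2 (6), p.35 l.1–18); `ϕ_v` «the Frobenius morphism of `Y_{L̂_v^♭,L_v}` ([FF18, Chapitre 2])» (Thm. 4.2.3 (2)), with
`ϕ_v = 1` for `v ∈ V^arc` (§4.5 p.26 l.64); `G v = G_v = Gal(L̄_v/L_v)` acting on `Y v` (p.21 l.49–55; proof p.23 l.14–22);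
the LOCAL action of `L* ⊂ L_v*` on `Y v` («natural Lubin–Tate action … any uniformizer operates by Frobenius … `𝒪*_{L_v}`
acts trivially» [FF18, Prop. 2.3.9], proof p.23 l.43–72; at `v ∈ V^arc` by `(z, r) ↦ |z|·r` on `ℝ_{>0}`, (2.4.2) and Prop.
2.4.3) together with the normalized valuation `ord_v : L* → ℤ` (trivial at `v ∈ V^arc`); `A v = Aut_{𝒪_{L_v}}(𝒢(𝒪_{F_v}))`
for a one-dimensional Lubin–Tate group `𝒢_v/𝒪_{L_v}` acting on `Y v` ([J-I] = arXiv:2106.11452 Thm. 7.29.1, as cited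
in Thm. 4.2.3 (6)–(7) and proof p.23 l.90–92; trivial group at `v ∈ V^arc`); the residue field `K v y = K_{y}` of a point
(«for each v one is given an untilt `(L_v ↪ K_v, K_v^♭ ≃ L̂_v^♭)`», Def. 5.1.1 p.29 l.49–58) — an algebraically closed
perfectoid field (archimedean: Def. 2.3.2) with its valuation `|−|_{K_y}` (§2.3) and the embedding `L_v ↪ K_y`; the standard
absolute values `|−|_v` ([Artin–Whaples 1945], §5.3 p.32 l.9–12) with the PRODUCT FORMULA (5.3.1)/(5.3.2) «for all `x ∈ L*`
one has `∏_{v ∈ V_L} |x|_v = 1`, or equivalently `Σ_{v ∈ V_L} log|x|_v = 0`»; and the NORMALIZATION COORDINATE (5.3.3)–(5.3.5)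
(p.32 l.22–44): «since the two valuations `|−|_v` and `|−|_{K_{ξ_v}}` on `L_v` are equivalent, there exist … real numbers
`α_v` such that `(L_v, |−|_v) = (L_v, |−|^{α_v}_{K_{ξ_v}})`» (`α_v > 0`, (5.3.5): `α_y ∈ ∏_v ℝ_{>0}`). UNINTERPRETED predicate
fields (no Mathlib notion): `IsMaxComplete` («maximally complete» [Kaplansky 1942]), `ResidueFieldOfCompletion`
/ `ResidueFieldFpBar` (the residue-field clauses of Prop. 4.7.2 (3) / 4.8.3 (3)); `valueGroupCompletion v` = the value group
of `L̂̄_v` (data). [claim: Joshi2023ATS2half, status: disputed] -/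
structure DeformationDatum (L : Type) [Field L] (V : Type) (Lv : V → Type) [∀ v, Field (Lv v)]
    (Y : V → Type) [∀ v, TopologicalSpace (Y v)] (K : (v : V) → Y v → Type) [∀ v y, Field (K v y)]
    [∀ v y, TopologicalSpace (K v y)] (G : V → Type) [∀ v, Group (G v)] (A : V → Type) [∀ v, Group (A v)] :
    Type where
  /-- which base fields `F_v` (Def. 4.1.1 / Rmk. 4.1.3 / Def. 4.7.1 / Def. 4.8.1) -/
  base : TiltBase
  /-- `V^arc_L ⊂ V_L`, the archimedean places (§2.2) -/
  Varc : Set V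
  /-- «The set `V_L` is countable» (proof of Lem. 4.1.2, p.20 l.74) -/
  countable_V : Countable V
  /-- the residue characteristic `p_v` of `v ∈ V^non` (§5 p.29 l.37; `p_v = 1` for `v ∈ V^arc`, Cor. 5.6.2 p.35 l.53–54) -/
  p : V → ℕ
  /-- `p_v` is prime for non-archimedean `v` -/
  p_prime : ∀ v, v ∉ Varc → (p v).Prime
  /-- `p_v = 1` for archimedean `v` -/
  p_arch : ∀ v, v ∈ Varc → p v = 1
  /-- `L ↪ L_v`, the completion of `L` at `v` (Def. 4.1.1 p.20 l.18) -/
  toLv : (v : V) → L →+* Lv v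
  /-- each `|Y_{F_v,L_v}|` is metrisable ([FF18, Prop. 2.3.2], p.20 l.79–89; `ℝ_{>0}` at `v ∈ V^arc`) -/
  metrizable : ∀ v, MetrizableSpace (Y v)
  /-- the point `y⁰_v` of the untilt `L̂̄_v` of `F_v` (proof of Thm. 5.5.2 (6), p.35 l.1–18) -/
  pt0 : (v : V) → Y v
  /-- `ϕ_v : |Y_{F_v,L_v}| → |Y_{F_v,L_v}|`, the Frobenius ([FF18, Ch. 2]; Thm. 4.2.3 (2)), a homeomorphism -/
  frob : (v : V) → Y v ≃ₜ Y v
  /-- `ϕ_v = 1` at archimedean `v` (§4.5 p.26 l.64 «one takes `π_v = 1` and `ϕ_v = 1`») -/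
  frob_arch : ∀ v, v ∈ Varc → frob v = Homeomorph.refl (Y v)
  /-- `G_v ↷ |Y_{F_v,L_v}|` (proof of Thm. 4.2.3 (1), p.23 l.14–22) -/
  gal : (v : V) → G v →* (Y v ≃ₜ Y v)
  /-- `ord_v : L* → ℤ`, the normalized discrete valuation at `v ∈ V^non` (the exponent in «powers of the Frobenius») -/
  ord : (v : V) → Lˣ →* Multiplicative ℤ
  /-- `ord_v` is trivial at archimedean `v` -/
  ord_arch : ∀ v, v ∈ Varc → ord v = 1
  /-- the local action `L* ⊂ L_v* ↷ |Y_{F_v,L_v}|` (Lubin–Tate, [FF18, Prop. 2.3.9], proof p.23 l.43–72; (2.4.2) at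
  `v ∈ V^arc`) -/
  act : (v : V) → Lˣ →* (Y v ≃ₜ Y v)
  /-- `Aut_{𝒪_{L_v}}(𝒢(𝒪_{F_v})) ↷ |Y_{F_v,L_v}|` ([J-I] Thm. 7.29.1; Thm. 4.2.3 (6)) -/
  lt : (v : V) → A v →* (Y v ≃ₜ Y v)
  /-- `|−|_{K_y}` on the residue field `K_y` of the point `y` (an untilt of `F_v`; §2.3, Def. 5.1.1) -/
  absK : (v : V) → (y : Y v) → K v y → ℝ
  /-- `(K_y, |−|_{K_y})` is a valued field (§2.3) -/
  absK_isValuedField : ∀ v y, IsValuedField (absK v y)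
  /-- `L_v ↪ K_y`, the untilt structure map (Def. 5.1.1 p.29 l.49–58) -/
  emb : (v : V) → (y : Y v) → Lv v →+* K v y
  /-- `|−|_v` on `L_v`, the standard (Artin–Whaples) absolute value (§5.3 p.32 l.9–12) -/
  absLv : (v : V) → Lv v → ℝ
  /-- `(L_v, |−|_v)` is a valued field (§2.3) -/
  absLv_isValuedField : ∀ v, IsValuedField (absLv v)
  /-- product formula, finiteness: for `x ∈ L*`, `|x|_v = 1` for all but finitely many `v` (implicit in (5.3.1)) -/
  finite_absLv_ne_one : ∀ x : Lˣ, {v | absLv v (toLv v x) ≠ 1}.Finite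
  /-- PRODUCT FORMULA (5.3.2): `Σ_{v ∈ V_L} log|x|_v = 0` for `x ∈ L*` ([Artin–Whaples 1945], p.32 l.9–21) -/
  sum_log_absLv : ∀ x : Lˣ, ∑ᶠ v, Real.log (absLv v (toLv v x)) = 0
  /-- the normalization coordinate `α_v = α_v(y_v) > 0` of (5.3.3)/(5.3.5) -/
  α : (v : V) → Y v → ℝ
  /-- `α_v > 0` ((5.3.5): `α_y ∈ ∏_v ℝ_{>0}`) -/
  α_pos : ∀ v y, 0 < α v y
  /-- (5.3.3): `|x|_v = |ι_y(x)|^{α_v}_{K_y}` for `x ∈ L_v` -/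
  absLv_eq_rpow : ∀ v y (x : Lv v), absLv v x = absK v y (emb v y x) ^ α v y
  /-- UNINTERPRETED: «`K_y` is a maximally complete field» (Prop. 4.7.2 (1) / 4.8.3 (1); [Kaplansky 1942]) -/
  IsMaxComplete : (v : V) → Y v → Prop
  /-- UNINTERPRETED: «the residue field of `K_{y_v}` is the residue field of `L̂̄_v`» (Prop. 4.7.2 (3)) -/
  ResidueFieldOfCompletion : (v : V) → Y v → Prop
  /-- UNINTERPRETED: «the residue field of `K_{y_v}` is `𝔽̄_{p_v}`» (Prop. 4.8.3 (3)) -/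
  ResidueFieldFpBar : (v : V) → Y v → Prop
  /-- DATA: the value group `|L̂̄_v*| ⊂ ℝ_{>0}` of the completed algebraic closure of `L_v` (Prop. 4.7.2 (2)) -/
  valueGroupCompletion : V → Set ℝ

namespace DeformationDatum

variable {L : Type} [Field L] {V : Type} {Lv : V → Type} [∀ v, Field (Lv v)] {Y : V → Type}
  [∀ v, TopologicalSpace (Y v)] {K : (v : V) → Y v → Type} [∀ v y, Field (K v y)] [∀ v y, TopologicalSpace (K v y)]
  {G : V → Type} [∀ v, Group (G v)] {A : V → Type} [∀ v, Group (A v)]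
  (D : DeformationDatum L V Lv Y K G A)

/-! ## §4.1 The adelic Fargues–Fontaine curve (Def. 4.1.1, Lem. 4.1.2, Rmk. 4.1.3) -/

/-- **[J-2½] Def. 4.1.1** (p.20 l.18–69): «the adelic Fargues–Fontaine curve is the product
`𝒴_L = ∏_{v ∈ V_L} |Y_{L̂_v^♭,L_v}|`» — the dependent product, with the product topology (p.20 l.89–91). The same
declaration is Rmk. 4.1.3's `𝒴′_L`, Def. 4.7.1's `𝒴^max_L` and Def. 4.8.1's `𝒴^ℝ_L` when `D.base` is `cp` / `maxComplete` /
`realified`. (`𝒳_L = ∏_v |X_{L̂_v^♭,L_v}|` is not typed: no statement below uses it; Rmk. 4.4.4 p.26 l.33–38: «the correct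
definition of `𝒳_L` should be `[𝒴_L/L*]`».) [claim: Joshi2023ATS2half, status: disputed] -/
abbrev Ycal (_D : DeformationDatum L V Lv Y K G A) : Type := (v : V) → Y v

/-- **[J-2½] Lem. 4.1.2** (p.20 l.72–91) = **Thm. 5.1.5** (p.31 l.1–8) DERIVED: «`𝒴_L` is a metrisable space» — «`V_L` is
countable … countable products of metric spaces and hence the product topology can be given by a metric» (Mathlib's
`PiCountable.metricSpace`, whose uniformity is the product uniformity). [claim: Joshi2023ATS2half, status: disputed] -/
theorem ycal_metrizable : MetrizableSpace D.Ycal := by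
  letI : ∀ v, MetricSpace (Y v) := fun v =>
    @TopologicalSpace.metrizableSpaceMetric (Y v) _ (D.metrizable v)
  letI : Encodable V := @Encodable.ofCountable V D.countable_V
  letI : MetricSpace ((v : V) → Y v) := PiCountable.metricSpace
  infer_instance

/-- Def. 4.1.1 proper: the datum is formed over `F_v = L̂̄_v^♭`. [claim: Joshi2023ATS2half, status: disputed] -/
def IsDef411 : Prop := D.base = TiltBase.algClosure

/-- **[J-2½] Rmk. 4.1.3** (p.20 l.92 – p.21 l.45): the variant `𝒴′_L = ∏_v |Y_{ℂ^♭_{p_v},L_v}|`, «established in a manner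
entirely analogous to that of `𝒴_L`». [claim: Joshi2023ATS2half, status: disputed] -/
def IsRmk413 : Prop := D.base = TiltBase.cp

/-- **[J-2½] Def. 4.7.1** (p.27 l.42 – p.28 l.16): the «maximally complete» variant `𝒴^max_L = ∏_v |Y_{L̂^{max♭}_v,L_v}|`.
[claim: Joshi2023ATS2half, status: disputed] -/
def IsDef471 : Prop := D.base = TiltBase.maxComplete

/-- **[J-2½] Def. 4.8.1** (p.28 l.58 – p.29 l.15): the «realified» variant `𝒴^ℝ_L = ∏_v |Y_{F_v,L_v}|`, `F_v = 𝒞^♭_{p_v}`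
(4.8.2). [claim: Joshi2023ATS2half, status: disputed] -/
def IsDef481 : Prop := D.base = TiltBase.realified

/-! ## §4.2 Galois and `L*` actions and the global Frobenius (Thm. 4.2.3, Cor. 4.2.5) -/

/-- The decorated group `G_L = ∏_{v ∈ V_L} G_v` of (4.2.1) (p.21 l.51–56, product topology). [claim: Joshi2023ATS2half,
status: disputed] -/
abbrev GalProd (_D : DeformationDatum L V Lv Y K G A) : Type := (v : V) → G v

/-- **[J-2½] Thm. 4.2.3 (1)** (p.21 l.68), CONSTRUCTED as in the proof (p.23 l.14–22: «`G_L` operates on `𝒴_L` … through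
the action of its factor `G_v` on the factor `Y_{L̂^♭_v,L_v}`»): `G_L ↷ 𝒴_L` by homeomorphisms. [claim: Joshi2023ATS2half,
status: disputed] -/
def galAction : D.GalProd →* (D.Ycal ≃ₜ D.Ycal) where
  toFun g := Homeomorph.piCongrRight fun v => D.gal v (g v)
  map_one' := by ext y v; simp
  map_mul' g h := by ext y v; simp

/-- **[J-2½] Thm. 4.2.3 (2)** (p.21 l.69–81) / **Cor. 4.2.5** (p.24 l.1–6): the GLOBAL FROBENIUS `ϕ : 𝒴_L → 𝒴_L`,
«given, for any `y ∈ 𝒴_L`, by `ϕ(y) = (ϕ_v(y_v))_{v ∈ V_L}`», a homeomorphism (each `ϕ_v` is). [claim: Joshi2023ATS2half,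
status: disputed] -/
def frobY : D.Ycal ≃ₜ D.Ycal := Homeomorph.piCongrRight D.frob

/-- Cor. 4.2.5's formula `ϕ(y) = (ϕ_v(y_v))_v` holds by construction. [claim: Joshi2023ATS2half, status: disputed] -/
@[simp] theorem frobY_apply (y : D.Ycal) (v : V) : D.frobY y v = D.frob v (y v) := rfl

/-- **[J-2½] Cor. 4.2.5** DERIVED (p.24 l.1–6: «a continuous global Frobenius mapping»). [claim: Joshi2023ATS2half,
status: disputed] -/
theorem continuous_frobY : Continuous D.frobY := D.frobY.continuous

/-- `ϕ` is the identity on the archimedean coordinates (§4.5 p.26 l.64). [claim: Joshi2023ATS2half, status: disputed] -/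
theorem frobY_apply_arch (y : D.Ycal) {v : V} (hv : v ∈ D.Varc) : D.frobY y v = y v := by
  simp [D.frob_arch v hv]

/-- **[J-2½] Thm. 4.2.3 (3)** (p.21 l.82), CONSTRUCTED as in the proof (p.23 l.26–32: «to define the action of `L*` on `𝒴_L`
it is enough to use the diagonal embedding `x ↦ (x)_{v ∈ V_L}` of `L* ↪ ∏_v L_v*`»): `L* ↷ 𝒴_L` factorwise through the
local actions. [claim: Joshi2023ATS2half, status: disputed] -/
def unitAction : Lˣ →* (D.Ycal ≃ₜ D.Ycal) where
  toFun x := Homeomorph.piCongrRight fun v => D.act v x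
  map_one' := by ext y v; simp
  map_mul' x x' := by ext y v; simp

/-- The `L*`-action is coordinatewise. [claim: Joshi2023ATS2half, status: disputed] -/
@[simp] theorem unitAction_apply (x : Lˣ) (y : D.Ycal) (v : V) : D.unitAction x y v = D.act v x (y v) := rfl

/-- **[J-2½] Thm. 4.2.3 (4)** (p.22 l.1–15): «for each non-archimedean `v ∈ V_L`, the `L*` action on each factor
`Y_{L̂^♭_v,L_v}` is through powers of the Frobenius morphism `ϕ_v`» — typed with the exponent the proof gives (p.23 l.43–72:
«any uniformizer of `𝒪_{L_v}` operates by Frobenius … the subgroup `𝒪*_{L_v} ⊂ L_v*` is trivial on `Y`»): `x` acts by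
`ϕ_v^{ord_v(x)}`. The clause «and this action changes local arithmetic holomorphic structures in the sense of [Joshi, 2022]»
and (5) «`L*` operates as a global Frobenius morphism on `𝒴_L` and moves arithmetic holomorphic structures» are prose (their
precise form is Thm. 4.4.1, not on the S-spine). [claim: Joshi2023ATS2half, status: disputed] -/
@[claim "Joshi2023ATS2half" "disputed"]
def LActsByFrobeniusPowers : Prop :=
  ∀ v, v ∉ D.Varc → ∀ x : Lˣ, D.act v x = D.frob v ^ (Multiplicative.toAdd (D.ord v x))

/-- **[J-2½] Thm. 4.2.3 (6)** (p.22 l.18–26), CONSTRUCTED factorwise: «one has a natural action of the group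
`∏_{v ∈ V^non_L} Aut_{𝒪_{L_v}}(𝒢(𝒪_{F_v}))` on `𝒴_L` which moves arithmetic holomorphic structures ([Joshi, 2021a])» (the
archimedean factors of `A` are trivial groups). (7) (p.22 l.27–39): «explicitly given … on primitive elements of degree one …
`σ_v([a_v] − π_v) = [σ_v(a_v)] − π_v` for any `a_v ∈ F_v` with `0 < |a_v|_{F_v} < 1`» = [J-I] Thm. 7.29.1 — typed in seat
E-t1's ATS-I file (merge-debt M-1), not restated; (8) (p.22 l.40–66): for `L = ℚ`, `𝒢_p = Ĝ_m`, the acting group is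
`∏_{p<∞} Aut_{ℤ_p}(1 + 𝔪_{ℂ^♭_p})`. Rmk. 4.2.4 (3) (p.22 l.75 – p.23 l.8) is where print relates this action to [IUTchIII]'s
(Ind2) — an E6 attach locator, no adjudication here. [claim: Joshi2023ATS2half, status: disputed] -/
def ltAction : ((v : V) → A v) →* (D.Ycal ≃ₜ D.Ycal) where
  toFun σ := Homeomorph.piCongrRight fun v => D.lt v (σ v)
  map_one' := by ext y v; simp
  map_mul' σ τ := by ext y v; simp

/-! ## §5.1 Arithmeticoids (Def. 5.1.1, Thm. 5.1.5) and §5.9 the global Frobenius of `L` (Def. 5.9.1) -/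

/-- **[J-2½] Def. 5.1.1** (p.29 l.48–58): «An ARITHMETICOID of `L` or an arithmetic deformation of `L` is a point `y ∈ 𝒴_L`.
I will write `arith(L)_y` … Giving an arithmeticoid means that for each `v ∈ V_L` one is given an untilt
`(L_v ↪ K_v, K^♭_v ≃ L̂^♭_v)`»; «equivalence of arithmeticoids [is] synonymous with equality» (p.30 l.6–9). So the type of
arithmeticoids IS `𝒴_L`. [claim: Joshi2023ATS2half, status: disputed] -/
abbrev Arith : Type := D.Ycal

/-- Def. 5.1.1 (p.29 l.59 – p.30 l.1): «the local data at `v` provided by `arith(L)_y`», the untilt `L_v ↪ K_{y_v}`.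
[claim: Joshi2023ATS2half, status: disputed] -/
def localDatum (y : D.Arith) (v : V) : Lv v →+* K v (y v) := D.emb v (y v)

/-- Def. 5.1.1 (p.30 l.1–5): «the topological ring (with the product topology) `∏_{v ∈ V_L} K_v` will be called the
ARITHMETIC RING of the arithmeticoid `arith(L)_y`» (ring structure and topology are the product ones). [claim:
Joshi2023ATS2half, status: disputed] -/
abbrev arithRing (y : D.Arith) : Type := (v : V) → K v (y v)

/-- **[J-2½] Lem. 5.1.3's embedding** (p.30 l.26–45): `ι_L : L ↪ R_y = ∏_v K_v`, «given by `x ↦ (x)_v`» through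
`L ↪ L_v ↪ K_{y_v}`. [claim: Joshi2023ATS2half, status: disputed] -/
def iotaL (y : D.Arith) : L →+* D.arithRing y := RingHom.pi fun v => (D.emb v (y v)).comp (D.toLv v)

/-- `ι_L` is coordinatewise `x ↦ ι_{y_v}(x)`. [claim: Joshi2023ATS2half, status: disputed] -/
@[simp] theorem iotaL_apply (y : D.Arith) (x : L) (v : V) : D.iotaL y x v = D.emb v (y v) (D.toLv v x) := rfl

/-- **[J-2½] Thm. 5.1.5** (p.31 l.1–8) DERIVED: «`𝒴_L` is a metrisable space» as a space of arithmeticoids, with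
«`d(arith(L)_{y₁}, arith(L)_{y₂}) = d(y₁, y₂)`» — i.e. Lem. 4.1.2 read on `Arith = 𝒴_L`. (Thm. 5.11.1 restates it for the three
variants.) [claim: Joshi2023ATS2half, status: disputed] -/
theorem arith_metrizable : MetrizableSpace D.Arith := D.ycal_metrizable

/-- **[J-2½] Def. 5.9.1** (p.36 l.40 – p.37 l.15): «Let `ϕ : 𝒴_L → 𝒴_L` be the global Frobenius morphism (Cor. 4.2.5) … Then
`arith(L)_y ↦ arith(L)_{ϕ(y)}` is called the GLOBAL FROBENIUS MORPHISM OF THE NUMBER FIELD `L`»; notation `L_y := arith(L)_y`,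
`L^{(1)}_y := L_{ϕ(y)}`, «the operation `L ↦ L^{(1)}`» (cited by [J-IV] Thm. 6.10.1). Rmk. 5.9.2: by Cor. 5.6.2 it is the
`p_v`-th power map on the local multiplicative structures. [claim: Joshi2023ATS2half, status: disputed] -/
def Lone (y : D.Arith) : D.Arith := D.frobY y

/-- `L^{(1)}_y` has `v`-component `ϕ_v(y_v)`. [claim: Joshi2023ATS2half, status: disputed] -/
@[simp] theorem Lone_apply (y : D.Arith) (v : V) : D.Lone y v = D.frob v (y v) := rfl

/-- The `n`-fold global Frobenius `L ↦ L^{(n)}` is the `n`-fold iterate coordinatewise. [claim: Joshi2023ATS2half, status: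
disputed] -/
theorem Lone_iterate (n : ℕ) (y : D.Arith) (v : V) : (D.Lone^[n]) y v = ((D.frob v)^[n]) (y v) := by
  induction n generalizing y with
  | zero => rfl
  | succ n ih => simp [Function.iterate_succ_apply', ih]

end DeformationDatum

end Summit.ABC.IUTFork.Joshi.ATS2h
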